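import Literature.NumberTheory.Automorphic.LanglandsTunnellModThree
import Literature.NumberTheory.Automorphic.StrongArtinGL2Proofs
import Literature.NumberTheory.Automorphic.PiOfArtinRepFrobSatakeCompatibleProofs
import Literature.NumberTheory.Automorphic.BCDTModularitySerreProofs
import Literature.NumberTheory.Automorphic.BCDTTheoremB
import Literature.NumberTheory.Automorphic.StrongArtinDihedralNotFixed
import Literature.NumberTheory.GaloisRepresentations.ArtinCharacterReciprocityProofs
import Literature.NumberTheory.Automorphic.ThorneQInfinityModularTheorem2Proofs
import Literature.NumberTheory.EllipticCurves.SemistableModPImageProofs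
import Literature.NumberTheory.GaloisRepresentations.ProjectiveTypeSolvable
import HarnessLib

/-!
# Stub-ideation k1, GENERATION 4 (HOME FAMILY 1 — recognise & import) for `stub_modThree`

Companion of `STUB-IDEAS-stub_modThree-1.md` (gen 4).  **No `sorry` in this file**: every helper is
either PROVED here from tree theorems or carried as a NAMED `Prop` hypothesis whose proof already sits in
an earlier companion (gen 2 `STUB_IDEAS_stub_modThree_1.lean`, ns `…Sketch.StubModThreeIdeasK1G2`:
H1 = `isModular_of_langlands_tunnell_at`, H3 = `isDihedralType_or_isOctahedralType_modThreeLift`) or is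
S-sized and typed in gen 3 (O1 = `…K1G3.isOctahedralType_modThreeLift_of_surjective`).

Delta w.r.t. gen 3 (`STUB_IDEAS_stub_modThree_1_g3.lean`, ns `…K1G3`) — two TREE MATCHES:

* **M1.** gen-3's Plan S (S0 ⇐ S1–S3, three `sorry`s) for a curve SEMISTABLE OVER `ℤ` **is the tree
  theorem** `Edixhoven1997_prop_2_1_holds` (Serre 1972 §5.4 Prop. 21 / Edixhoven 1997 Prop. 2.1,
  `EllipticCurves/SemistableModPImageProofs`, proved 2026-08-16) read through
  `hasSurjectiveModNGaloisRep_of_hasIrreducibleModPGaloisRep`; the framed/intrinsic dictionary is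
  `Thorne2016.hasIrreducibleModPGaloisRep_of_isIrreducible` + the landed
  `Summit.ABC.ABC.Theorems.surjective_of_hasSurjectiveModNGaloisRep` (proof repeated here as
  `surjective_of_hasSurjectiveModNGaloisRep'`).  ⇒ `surjective_three_of_isSemistable`
  and `isModular_of_isSemistable : SurjectiveCore → …` are PROVED (XS glue, no new mathematics).
* **M2.** gen-3's Plan D Galois half (D1 + D3: `ρ̄`/`σ` dihedral ⇒ induced from a finite-order Hecke
  character of a quadratic `M`, Frobenius polynomials at almost all `v`, WITH regularity) **is the tree
  theorem** `exists_heckeCharacter_frobPoly_of_isDihedralType` (`Automorphic/LanglandsTunnellMonomial`)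
  with its reciprocity input DISCHARGED by the theorem `artinReciprocity_character_holds`
  (`GaloisRepresentations/ArtinCharacterReciprocityProofs`; packaged unconditionally as
  `FramedArtinRep.exists_heckeCharacter_frobPoly_of_isDihedralType` in `StrongArtinGL2DihedralOfInduction`).  ⇒ the dihedral leaf of Langlands–Tunnell costs exactly
  Jacquet–Langlands Prop. 12.1 **over `ℚ` only** (`QuadraticInductionRat`, typed below); the assembly
  `exists_isPiOfArtinRep_of_isDihedralType_rat` is PROVED (the tree's 8-line proof at `F = ℚ`).
* ★ closer `stub_modThree_of_quadInductionRat_octahedral`: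
  `H1 → H3 → QuadraticInductionRat → StrongArtinOctahedralRat → exists_isNewform1_of_isPiOfArtinRep → StubModThree`
  (kernel-checked), and ★ `surjectiveCore_of_octahedralRat` / `isModular_of_isSemistable` for the
  semistable sub-family (only {Tunnell-octahedral over `ℚ`, Gelbart Prop. 4.2} are ever exercised there).

Nothing here is registered; the stub statement is copied verbatim as `StubModThree`.
-/

noncomputable section

open scoped MatrixGroups NumberField Polynomial
open NumberField IsDedekindDomain Polynomial CongruenceSubgroup Field
open Literature.NumberTheory.EllipticCurves
open Literature.NumberTheory.EllipticCurves.ModularForms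
open Literature.NumberTheory.Automorphic
open Literature.NumberTheory.GaloisRepresentations
open Literature.NumberTheory.GaloisRepresentations.GL2F3Lift
open Literature.NumberTheory.LFunctions
open WeierstrassCurve
open Matrix

set_option linter.dupNamespace false

namespace Summit.ABC.ABC.Cruxes.FreyModularity.Sketch.StubModThreeIdeasK1G4

/-- The registered stub statement, verbatim. -/
def StubModThree : Prop :=
  ∀ (W : WeierstrassCurve ℚ) [W.IsElliptic] (ρ : ModPGaloisRep ℚ (ZMod 3) 2),
    W.IsTorsionGaloisRep 3 ρ → FramedRep.IsAbsolutelyIrreducible ρ → ρ.IsModular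

/-! ## Gen-2 pieces (all PROVED in `…Sketch.StubModThreeIdeasK1G2`), carried by name -/

/-- gen-2 **H0** (proved there; 3-line proof repeated so this file is self-contained). -/
theorem isOdd_of_isTorsionGaloisRep_three (W : WeierstrassCurve ℚ) [W.IsElliptic]
    (ρ : ModPGaloisRep ℚ (ZMod 3) 2) (hρ : W.IsTorsionGaloisRep 3 ρ) :
    FramedGaloisRep.IsOdd ρ := by
  haveI : NeZero ((3 : ℕ) : ℚ) := ⟨by norm_num⟩
  exact ModPGaloisRep.isOdd_of_det_eq_modPCyclotomicCharacterZMod ρ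
    (W.det_eq_modPCyclotomicCharacter_of_isTorsionGaloisRep_holds 3 ρ hρ)

/-- gen-2 **H1** as a Prop (PROVED in gen 2 as `isModular_of_langlands_tunnell_at`): per-`σ`
Langlands–Tunnell descent `langlands_tunnell (Ψ ∘ ρ̄) ⇒ ρ̄ modular`. -/
def H1PerSigmaDescent : Prop :=
  ∀ ρ : ModPGaloisRep ℚ (ZMod 3) 2, langlands_tunnell (modThreeLift ρ) →
    FramedRep.IsAbsolutelyIrreducible ρ → FramedGaloisRep.IsOdd ρ → ρ.IsModular

/-- gen-2 **H3** as a Prop (PROVED in gen 2 as `isDihedralType_or_isOctahedralType_modThreeLift`). -/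
def H3DihedralOrOctahedral : Prop :=
  ∀ ρ : ModPGaloisRep ℚ (ZMod 3) 2, FramedRep.IsAbsolutelyIrreducible ρ → FramedGaloisRep.IsOdd ρ →
    IsDihedralType (modThreeLift ρ).toMonoidHom ∨ IsOctahedralType (modThreeLift ρ).toMonoidHom

/-- gen-2 **H4** (proved there; repeated, 8 lines): Langlands–Tunnell for ONE `σ` from `π(σ)` and
Gelbart Prop. 4.2; Prop. 4.1 is the tree THEOREM `frobSatakeCompatibleAt_of_isPiOfArtinRep_holds`. -/
theorem langlands_tunnell_of_exists_isPiOfArtinRep (hW1 : exists_isNewform1_of_isPiOfArtinRep)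
    (σ : FramedArtinRep ℚ 2)
    (hπ : σ.toGaloisRep.IsIrreducible →
      ∃ (hcpt : isCompact_glFiniteIntegralLevel 2 ℚ) (π : CuspidalAutomorphicRepData 2 ℚ hcpt),
        IsPiOfArtinRep σ π.1) :
    langlands_tunnell σ := by
  intro hirr hodd _hsolv
  obtain ⟨hcpt, π, hπ⟩ := hπ hirr
  obtain ⟨N, hN, f, hf, -, hsat⟩ := hW1 hcpt σ π hirr hodd hπ
  refine ⟨N, hN, f, hf, fun v hv => ?_⟩
  obtain ⟨α, hα, hpoly⟩ := hsat v hv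
  obtain ⟨hur, hchar⟩ := frobSatakeCompatibleAt_of_isPiOfArtinRep_holds hcpt σ π hπ v α hα
  exact ⟨hur, hpoly ▸ hchar⟩

/-! ## M1 — Plan S for a semistable curve is a TREE THEOREM (Serre Prop. 21 = `Edixhoven1997_prop_2_1_holds`) -/

/-- **G1** (framed ⇒ intrinsic dictionary, PROVED by import): an absolutely irreducible framed model
`ρ̄` of `E[3]` makes `E[3]` an irreducible `Γ_ℚ`-module (`HasIrreducibleModPGaloisRep`).
Tree: `Thorne2016.hasIrreducibleModPGaloisRep_of_isIrreducible`. -/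
theorem hasIrreducibleModPGaloisRep_three_of_isAbsolutelyIrreducible (W : WeierstrassCurve ℚ)
    [W.IsElliptic] (ρ : ModPGaloisRep ℚ (ZMod 3) 2) (hρ : W.IsTorsionGaloisRep 3 ρ)
    (habs : FramedRep.IsAbsolutelyIrreducible ρ) : W.HasIrreducibleModPGaloisRep 3 := by
  haveI : Fact (Nat.Prime 3) := ⟨Nat.prime_three⟩
  exact Thorne2016.hasIrreducibleModPGaloisRep_of_isIrreducible hρ habs.isIrreducible

/-- **Abstract surjectivity ⇒ framed surjectivity** (folklore dictionary; this is the LANDED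
`Summit.ABC.ABC.Theorems.surjective_of_hasSurjectiveModNGaloisRep` of
`Theorems/DefiniteXiFreyModularityStubFreyCaseBThreeReducible`, proof copied verbatim so that this
companion does not import a Summits module the farm snapshot may not have built). -/
theorem surjective_of_hasSurjectiveModNGaloisRep' {F : Type} [Field F] {W : WeierstrassCurve F}
    {p : ℕ} [Fact p.Prime] (hs : W.HasSurjectiveModNGaloisRep (p : ℤ)) {ρ : ModPGaloisRep F (ZMod p) 2}
    (hρ : W.IsTorsionGaloisRep p ρ) : Function.Surjective ρ := by
  obtain ⟨e, he⟩ := hρ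
  intro M
  -- the additive automorphism `v ↦ M v` of `𝔽_p²`
  let f : (Fin 2 → ZMod p) ≃+ (Fin 2 → ZMod p) :=
    { toFun := fun v ↦ (M : Matrix (Fin 2) (Fin 2) (ZMod p)) *ᵥ v
      invFun := fun v ↦ ((M⁻¹ : GL (Fin 2) (ZMod p)) : Matrix (Fin 2) (Fin 2) (ZMod p)) *ᵥ v
      left_inv := fun v ↦ by
        simp only [Matrix.mulVec_mulVec, Units.inv_mul, Matrix.one_mulVec]
      right_inv := fun v ↦ by
        simp only [Matrix.mulVec_mulVec, Units.mul_inv, Matrix.one_mulVec]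
      map_add' := fun v w ↦ Matrix.mulVec_add _ _ _ }
  have hf : ∀ v, f v = (M : Matrix (Fin 2) (Fin 2) (ZMod p)) *ᵥ v := fun _ ↦ rfl
  -- `e⁻¹ ∘ M ∘ e` is `σ • ·` for some `σ`
  obtain ⟨σ, hσ⟩ := hs (Multiplicative.ofAdd (e.trans (f.trans e.symm)))
  have hσP : ∀ P : geomTorsion W p, σ • P = e.symm (f (e P)) := fun P ↦ by
    have h := W.galoisRepTorsion_apply (p : ℤ) σ P
    rw [hσ, toAdd_ofAdd] at h
    exact h.symm
  refine ⟨σ, ?_⟩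
  -- compare the two matrices on every vector
  have hv : ∀ v : Fin 2 → ZMod p,
      ((ρ σ : GL (Fin 2) (ZMod p)) : Matrix (Fin 2) (Fin 2) (ZMod p)) *ᵥ v =
        (M : Matrix (Fin 2) (Fin 2) (ZMod p)) *ᵥ v := fun v ↦ by
    have h := he σ (e.symm v)
    rw [hσP, AddEquiv.apply_symm_apply, AddEquiv.apply_symm_apply, hf] at h
    exact h.symm
  have hmat : ((ρ σ : GL (Fin 2) (ZMod p)) : Matrix (Fin 2) (Fin 2) (ZMod p)) =
      (M : Matrix (Fin 2) (Fin 2) (ZMod p)) :=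
    Matrix.toLin'.injective (LinearMap.ext fun v ↦ by rw [Matrix.toLin'_apply, Matrix.toLin'_apply, hv])
  exact Units.ext hmat

/-- **S0′ = gen-3's S0 for `W` semistable over `ℤ`, PROVED** (no S1–S3 needed): Serre 1972 §5.4
Prop. 21 / Edixhoven 1997 Prop. 2.1 is the tree theorem `Edixhoven1997_prop_2_1_holds`; its corollary
`hasSurjectiveModNGaloisRep_of_hasIrreducibleModPGaloisRep` gives `Γ_ℚ ↠ Aut(E[3])`, and the landed
`surjective_of_hasSurjectiveModNGaloisRep` transports surjectivity to the framed model. -/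
theorem surjective_three_of_isSemistable (W : WeierstrassCurve ℚ) [W.IsElliptic]
    (ρ : ModPGaloisRep ℚ (ZMod 3) 2) (hρ : W.IsTorsionGaloisRep 3 ρ)
    (habs : FramedRep.IsAbsolutelyIrreducible ρ) (hW : W.IsSemistable ℤ) :
    Function.Surjective ρ := by
  haveI : Fact (Nat.Prime 3) := ⟨Nat.prime_three⟩
  have hs : W.HasSurjectiveModNGaloisRep ((3 : ℕ) : ℤ) :=
    hasSurjectiveModNGaloisRep_of_hasIrreducibleModPGaloisRep Edixhoven1997_prop_2_1_holds W hW
      Nat.prime_three (hasIrreducibleModPGaloisRep_three_of_isAbsolutelyIrreducible W ρ hρ habs)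
  exact surjective_of_hasSurjectiveModNGaloisRep' hs hρ

/-- The **surjective core** of the stub (as in gen 3 / k3's `tunnellCore`): modularity of `ρ̄_{E,3}` when
it is ONTO `GL₂(𝔽₃)`. -/
def SurjectiveCore : Prop :=
  ∀ (W : WeierstrassCurve ℚ) [W.IsElliptic] (ρ : ModPGaloisRep ℚ (ZMod 3) 2),
    W.IsTorsionGaloisRep 3 ρ → Function.Surjective ρ → ρ.IsModular

/-- ★ **Semistable use-site, PROVED**: for `E/ℚ` semistable the stub instance needs ONLY the surjective
core — the dihedral leaf of Langlands–Tunnell is never exercised (gen-3's `isModular_of_isSemistable_awayThree`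
without its three `sorry`s, at the price of semistability AT EVERY prime, which is what the tree theorem
is stated for). -/
theorem isModular_of_isSemistable (hcore : SurjectiveCore) (W : WeierstrassCurve ℚ) [W.IsElliptic]
    (ρ : ModPGaloisRep ℚ (ZMod 3) 2) (hρ : W.IsTorsionGaloisRep 3 ρ)
    (habs : FramedRep.IsAbsolutelyIrreducible ρ) (hW : W.IsSemistable ℤ) : ρ.IsModular :=
  hcore W ρ hρ (surjective_three_of_isSemistable W ρ hρ habs hW)

/-! ## M2 — the dihedral leaf: Galois half in the tree, automorphic half = JL Prop. 12.1 over `ℚ` only -/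

/-- **Jacquet–Langlands Prop. 12.1 over `ℚ`** — the hypothesis `hJL` of the tree's
`strongArtin_of_isDihedralType_of_quadraticInduction`, RESTRICTED to the base field `ℚ` (which is all
the stub ever uses): for a quadratic `E/ℚ` and a finite-order Hecke character `ω` of `E` not fixed by
`Aut(E/ℚ)`, a cuspidal `π` on `GL₂(𝔸_ℚ)` with Satake polynomials `∏_{w ∣ p} (X^{f(w|p)} - ω(ϖ_w))` for
almost all `p`.  (Over `ℚ` and for the ODD inductions met here this is Hecke 1926 / Maass 1949: theta
series of quadratic Hecke characters, Bump 1997 Thm. 1.9.1 and p. 110.)  XL as an automorphic fact,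
L as a classical one. -/
def QuadraticInductionRat : Prop :=
  ∀ (E : Type) [Field E] [NumberField E] [Algebra ℚ E] [Algebra.IsQuadraticExtension ℚ E]
    (ω : HeckeCharacter E), ω.IsFiniteOrder →
      (∃ (τ : E ≃ₐ[ℚ] E) (x : ideleGroup E), ω (τ • x) ≠ ω x) →
      ∀ (hF : isCompact_glFiniteIntegralLevel 2 ℚ),
        ∃ π : CuspidalAutomorphicRepData 2 ℚ hF,
          ∀ᶠ v : HeightOneSpectrum (𝓞 ℚ) in Filter.cofinite, ∃ α : Multiset ℂ,
            π.1.HasSatakeParamAt v α ∧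
              satakePolynomial α =
                ∏ᶠ w ∈ {w : HeightOneSpectrum (𝓞 E) | w.under (𝓞 ℚ) = v},
                  (X ^ w.asIdeal.inertiaDeg (𝓞 ℚ) - C (ω.valueAtUniformizer w))

/-- The tree's all-number-fields `hJL` implies the `ℚ`-restricted one (bookkeeping, PROVED). -/
theorem quadraticInductionRat_of_hJL
    (hJL : ∀ (F E : Type) [Field F] [NumberField F] [Field E] [NumberField E] [Algebra F E]
      [Algebra.IsQuadraticExtension F E] (ω : HeckeCharacter E),
      ω.IsFiniteOrder →
        (∃ (σ : E ≃ₐ[F] E) (x : ideleGroup E), ω (σ • x) ≠ ω x) →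
        ∀ (hF : isCompact_glFiniteIntegralLevel 2 F),
          ∃ π : CuspidalAutomorphicRepData 2 F hF,
            ∀ᶠ v : HeightOneSpectrum (𝓞 F) in Filter.cofinite, ∃ α : Multiset ℂ,
              π.1.HasSatakeParamAt v α ∧
                satakePolynomial α =
                  ∏ᶠ w ∈ {w : HeightOneSpectrum (𝓞 E) | w.under (𝓞 F) = v},
                    (X ^ w.asIdeal.inertiaDeg (𝓞 F) - C (ω.valueAtUniformizer w))) :
    QuadraticInductionRat :=
  fun E _ _ _ _ ω hfin hnf hF => hJL ℚ E ω hfin hnf hF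

/-- ★ **Strong Artin for dihedral-type `σ : Γ_ℚ → GL₂(ℂ)`, PROVED from `QuadraticInductionRat` alone**
(the tree's `strongArtin_of_isDihedralType_of_reciprocity_of_quadraticInduction`, 8 lines, at `F = ℚ`;
the Galois half is the unconditional tree theorem `FramedArtinRep.exists_heckeCharacter_frobPoly_of_isDihedralType`). -/
theorem exists_isPiOfArtinRep_of_isDihedralType_rat (hJL : QuadraticInductionRat)
    (σ : FramedArtinRep ℚ 2) (hD : IsDihedralType σ.toMonoidHom) :
    ∃ (hcpt : isCompact_glFiniteIntegralLevel 2 ℚ) (π : CuspidalAutomorphicRepData 2 ℚ hcpt),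
      IsPiOfArtinRep σ π.1 := by
  classical
  haveI : Finite σ.toMonoidHom.range := finite_range_toMonoidHom σ
  -- the Galois half: a TREE THEOREM (reciprocity input = `artinReciprocity_character_holds`); this is
  -- `FramedArtinRep.exists_heckeCharacter_frobPoly_of_isDihedralType` of `StrongArtinGL2DihedralOfInduction`
  -- spelled through its two (built) parents.
  obtain ⟨M, _, _, _, _, hMdeg, ω, hωfin, hreg, hae⟩ :=
    Literature.NumberTheory.Automorphic.exists_heckeCharacter_frobPoly_of_isDihedralType
      artinReciprocity_character_holds σ hD
  haveI : Algebra.IsQuadraticExtension ℚ M := { finrank_eq_two' := hMdeg }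
  obtain ⟨π, hπ⟩ := hJL M ω hωfin (ω.exists_smul_ne_of_regular hreg)
    (isCompact_glFiniteIntegralLevel_holds 2 ℚ)
  refine ⟨isCompact_glFiniteIntegralLevel_holds 2 ℚ, π, (hπ.and hae).mono ?_⟩
  rintro v ⟨⟨α, hα, hpoly⟩, hσv, hchar⟩
  exact ⟨α, hα, hσv, hpoly ▸ hchar⟩

/-- **Langlands–Tunnell for ONE dihedral-type `σ` over `ℚ`** from {`QuadraticInductionRat`, Gelbart 4.2}
(PROVED). -/
theorem langlands_tunnell_of_isDihedralType_rat (hJL : QuadraticInductionRat)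
    (hW1 : exists_isNewform1_of_isPiOfArtinRep) (σ : FramedArtinRep ℚ 2)
    (hD : IsDihedralType σ.toMonoidHom) : langlands_tunnell σ :=
  langlands_tunnell_of_exists_isPiOfArtinRep hW1 σ fun _ ↦
    exists_isPiOfArtinRep_of_isDihedralType_rat hJL σ hD

/-! ## M3 — the residual debt: Tunnell's octahedral case, over `ℚ` only -/

/-- **Tunnell 1981 over `ℚ`** — the named fact `strongArtin_of_isOctahedralType` RESTRICTED to the base
field `ℚ` (all the stub uses; its only instances are the lifts `Ψ ∘ ρ̄` of SURJECTIVE `ρ̄ : Γ_ℚ ↠ GL₂(𝔽₃)`).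
XL; no finer Family-1 import found (the tree already splits it into Langlands base change ×3,
Gelbart–Jacquet, Jacquet–Shalika, Arthur–Clozel fibres, JPSS cubic: `strongArtin_of_isOctahedralType_of_leaves'`). -/
def StrongArtinOctahedralRat : Prop :=
  ∀ σ : FramedArtinRep ℚ 2, σ.toGaloisRep.IsIrreducible → IsOctahedralType σ.toMonoidHom →
    ∃ (hcpt : isCompact_glFiniteIntegralLevel 2 ℚ) (π : CuspidalAutomorphicRepData 2 ℚ hcpt),
      IsPiOfArtinRep σ π.1

/-- The catalogued fact implies its `ℚ`-restriction (bookkeeping, PROVED). -/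
theorem strongArtinOctahedralRat_of_fact (ho : strongArtin_of_isOctahedralType) :
    StrongArtinOctahedralRat :=
  fun σ hirr hO => ho σ hirr hO

/-- gen-3 **O1** as a Prop (typed in gen 3 as `isOctahedralType_modThreeLift_of_surjective`, S-sized:
`PGL₂(𝔽₃) ≃ S₄` and `Ψ` preserves the projective image). -/
def O1OctahedralOfSurjective : Prop :=
  ∀ ρ : ModPGaloisRep ℚ (ZMod 3) 2, Function.Surjective ρ → IsOctahedralType (modThreeLift ρ).toMonoidHom

/-- ★ **SurjectiveCore from {Tunnell over `ℚ`, Gelbart 4.2}** granted H1 (gen 2, proved) and O1 (gen 3, S).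
PROVED. -/
theorem surjectiveCore_of_octahedralRat (hH1 : H1PerSigmaDescent) (hO1 : O1OctahedralOfSurjective)
    (ho : StrongArtinOctahedralRat) (hW1 : exists_isNewform1_of_isPiOfArtinRep) : SurjectiveCore := by
  intro W _ ρ hρ hs
  have habs : FramedRep.IsAbsolutelyIrreducible ρ :=
    (BCDT.isAbsIrreducibleOverSqrt_neg_three_of_surjective ρ hs).isAbsolutelyIrreducible
  have hodd := isOdd_of_isTorsionGaloisRep_three W ρ hρ
  refine hH1 ρ ?_ habs hodd
  exact langlands_tunnell_of_exists_isPiOfArtinRep hW1 (modThreeLift ρ) fun hirr ↦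
    ho (modThreeLift ρ) hirr (hO1 ρ hs)

/-! ## ★ The gen-4 closer: every leaf either a tree theorem or a `ℚ`-restricted named fact -/

/-- ★ **`stub_modThree` from {JL Prop. 12.1 over `ℚ`, Tunnell over `ℚ`, Gelbart Prop. 4.2}**, granted the
gen-2 PROVED H1 and H3 (kernel-checked assembly; compare gen 2's `stub_modThree_of_dihedral_octahedral`,
whose dihedral input was the all-number-fields `strongArtin_of_isDihedralType`, and gen 3's
`stub_modThree_of_cmFact_octahedral`, whose dihedral input needed D1–D3). -/
theorem stub_modThree_of_quadInductionRat_octahedral (hH1 : H1PerSigmaDescent)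
    (hH3 : H3DihedralOrOctahedral) (hJL : QuadraticInductionRat) (ho : StrongArtinOctahedralRat)
    (hW1 : exists_isNewform1_of_isPiOfArtinRep) : StubModThree := by
  intro W _ ρ hρ habs
  have hodd := isOdd_of_isTorsionGaloisRep_three W ρ hρ
  refine hH1 ρ ?_ habs hodd
  refine langlands_tunnell_of_exists_isPiOfArtinRep hW1 (modThreeLift ρ) fun hirr ↦ ?_
  rcases hH3 ρ habs hodd with hD | hO
  · exact exists_isPiOfArtinRep_of_isDihedralType_rat hJL (modThreeLift ρ) hD
  · exact ho (modThreeLift ρ) hirr hO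

/-- The same closer fed with the tree's all-fields `hJL` and the catalogued octahedral fact (PROVED):
today's `stub_modThree_of_langlands_tunnell` with the dihedral third of `langlands_tunnell` paid by
JL Prop. 12.1 instead of `strongArtin_of_isDihedralType`. -/
theorem stub_modThree_of_hJL_octahedral (hH1 : H1PerSigmaDescent) (hH3 : H3DihedralOrOctahedral)
    (hJL : ∀ (F E : Type) [Field F] [NumberField F] [Field E] [NumberField E] [Algebra F E]
      [Algebra.IsQuadraticExtension F E] (ω : HeckeCharacter E),
      ω.IsFiniteOrder →
        (∃ (σ : E ≃ₐ[F] E) (x : ideleGroup E), ω (σ • x) ≠ ω x) →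
        ∀ (hF : isCompact_glFiniteIntegralLevel 2 F),
          ∃ π : CuspidalAutomorphicRepData 2 F hF,
            ∀ᶠ v : HeightOneSpectrum (𝓞 F) in Filter.cofinite, ∃ α : Multiset ℂ,
              π.1.HasSatakeParamAt v α ∧
                satakePolynomial α =
                  ∏ᶠ w ∈ {w : HeightOneSpectrum (𝓞 E) | w.under (𝓞 F) = v},
                    (X ^ w.asIdeal.inertiaDeg (𝓞 F) - C (ω.valueAtUniformizer w)))
    (ho : strongArtin_of_isOctahedralType) (hW1 : exists_isNewform1_of_isPiOfArtinRep) : StubModThree :=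
  stub_modThree_of_quadInductionRat_octahedral hH1 hH3 (quadraticInductionRat_of_hJL hJL)
    (strongArtinOctahedralRat_of_fact ho) hW1

end Summit.ABC.ABC.Cruxes.FreyModularity.Sketch.StubModThreeIdeasK1G4

end
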